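import Summits.ValiantsHypothesis.ValiantsHypothesis.Theorems.BarrierLeverPartitionMinorsChowLeafStep
import Summits.ValiantsHypothesis.ValiantsHypothesis.Theorems.BarrierLeverPartitionMinorsChowSizeFive

/-!
# Route BarrierLever — Chow witnesses for partition minors (item 20172, CPM): the LEAF-CORE ENGINE
# (locked ∧ unpeelable ∧ no leaf step on either side)

Helper file (`--supports stmt-ValiantsHypothesis-20172`; cell valiant-natproofs, rung V4, 𝒟-side of
door (c); seat val-np-p4 gen 13).  Closes NO item.  Conventions of items 19717 / 20172 / 20195: a
layout `(u, w)` of height `h` (`u w : Fin r → Finset (Fin h)`) is HIT when some product of `h + h`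
affine forms has nonsingular partition minor `det[coeff_{E (u i) (w j)} ∏ ℓ]`.

`chow_hit_of_leafCore` — **if every LEAF-CORE layout is hit then every injective layout is hit**,
where a leaf-core layout is a core layout in the sense of `chow_hit_of_core` (injective, LOCKED,
UNPEELABLE at every pair of coordinates, of size `r ≥ h + 1`) which moreover admits NO LEAF STEP
(`chow_leafStep`, file `…ChowLeafStep`) on either side:

* (row side) for every row coordinate `a` that is LONELY (the `a`-status of one row differs from
  that of all other rows) and every column coordinate `c` with an edge `w j₀ = (w j₁).erase c`
  (`j₁ ≠ j₀`), the `c`-erasure of the columns is NOT injective off `j₁` (the coordinate `c` carries a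
  second edge);
* (column side) the same with rows and columns exchanged.

Proof: induction on the size bound `R` through val-np-p4 g12's bounded core engine
`chow_hit_of_core_le`: a core of size `r ≤ R + 1` that admits a leaf step is hit by `chow_leafStep`
(after `chow_hit_swap` for the column side), because the reduced layout has size `r - 1 ≤ R` and is
injective (`preimage_succAbove_injective_of_lonely`, `preimage_succAbove_injective_of_injOn`), hence
hit by the induction hypothesis; a core without leaf step is hit by assumption.

`exists_leafCore_of_not_hit` — the contrapositive: a layout missed by all products of `h + h` affine
forms, if any, yields a missed LEAF-CORE layout.  For the census of minimal counterexample candidates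
this removes, at size `r = h + 1`, every core `Tree × 𝒲` (one side is a rainbow spanning tree there,
all of whose leaf edges are lonely coordinates) in which some coordinate of `𝒲` carries exactly one
edge — e.g. `384` of the `1 280` degree-class column families against star rows at `(h, r) = (4, 5)`
are even fully leaf-contractible (seat count; the kit census of the surviving `(4,6)`, `(5,6)`, `(5,7)`
cores is reported on the cell bus).

WHAT THIS IS NOT: an organising principle (reduction), not a hit: the surviving leaf-cores (e.g. star
rows against a padded sub-cube of columns, where every column coordinate carries `0` or `≥ 2` edges)
are untouched; nothing on items 20172 / 20195 / 19717 themselves, on crux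
stmt-ValiantsHypothesis-14610, or on `VP` versus `VNP`.
-/

set_option linter.dupNamespace false

namespace Summit.ValiantsHypothesis.ValiantsHypothesis.Theorems.BarrierLever.ChowFactor

open Finset MvPolynomial

noncomputable section

/-! ## 1. Injectivity of the reduced layouts -/

/-- Equal pull-backs along `a.succAbove` have equal `a`-erasures. -/
theorem erase_eq_of_preimage_succAbove_eq {h : ℕ} (a : Fin (h + 1)) {S T : Finset (Fin (h + 1))}
    (he : S.preimage a.succAbove Fin.succAbove_right_injective.injOn =
      T.preimage a.succAbove Fin.succAbove_right_injective.injOn) :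
    S.erase a = T.erase a := by
  rw [erase_eq_map_preimage_succAbove, erase_eq_map_preimage_succAbove, he]

/-- **Dropping the lonely row keeps the reduced rows injective**: if the `a`-status of every row
`i ≠ i₁` is the opposite of that of row `i₁`, the rows `i ≠ i₁` with `a` deleted (pulled back along
`a.succAbove`, listed along `i₁.succAbove`) are pairwise distinct. -/
theorem preimage_succAbove_injective_of_lonely {h r : ℕ} (a : Fin (h + 1))
    (u : Fin (r + 1) → Finset (Fin (h + 1))) (hu : Function.Injective u) (i₁ : Fin (r + 1))
    (hlone : ∀ i, i ≠ i₁ → (a ∈ u i ↔ a ∉ u i₁)) :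
    Function.Injective fun k : Fin r =>
      (u (i₁.succAbove k)).preimage a.succAbove Fin.succAbove_right_injective.injOn := by
  intro k k' hkk
  have he := erase_eq_of_preimage_succAbove_eq a hkk
  by_contra hne
  have hne' : u (i₁.succAbove k) ≠ u (i₁.succAbove k') := fun e =>
    hne (Fin.succAbove_right_injective (hu e))
  have hst := (mem_iff_of_erase_eq he hne').2
  have h1 := hlone _ (Fin.succAbove_ne i₁ k)
  have h2 := hlone _ (Fin.succAbove_ne i₁ k')
  exact hst (h1.trans h2.symm)

/-- **Dropping one end of the unique edge keeps the reduced columns injective**: if the `c`-erasure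
is injective on the columns `j ≠ j₁`, the columns `j ≠ j₁` with `c` deleted are pairwise distinct. -/
theorem preimage_succAbove_injective_of_injOn {h r : ℕ} (c : Fin (h + 1))
    (w : Fin (r + 1) → Finset (Fin (h + 1))) (j₁ : Fin (r + 1))
    (hinj : Set.InjOn (fun j => (w j).erase c) {j | j ≠ j₁}) :
    Function.Injective fun l : Fin r =>
      (w (j₁.succAbove l)).preimage c.succAbove Fin.succAbove_right_injective.injOn := by
  intro l l' hll
  have he := erase_eq_of_preimage_succAbove_eq c hll
  exact Fin.succAbove_right_injective
    (hinj (Fin.succAbove_ne j₁ l) (Fin.succAbove_ne j₁ l') he)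

/-- The far end of an edge contains its coordinate. -/
theorem mem_of_edge {h r : ℕ} {c : Fin h} (w : Fin r → Finset (Fin h)) (hw : Function.Injective w)
    {j₁ j₀ : Fin r} (hj : j₁ ≠ j₀) (hj₀ : w j₀ = (w j₁).erase c) : c ∈ w j₁ := by
  by_contra hc
  rw [Finset.erase_eq_of_notMem hc] at hj₀
  exact hj (hw hj₀.symm)

/-! ## 2. The leaf-core engine -/

/-- **LEAF-CORE ENGINE (bounded form).**  If every injective layout that is locked, unpeelable, of
size `r ≥ h + 1` and admits no leaf step on either side is hit, then every injective layout of size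
`r ≤ R` is hit. -/
theorem chow_hit_of_leafCore_le
    (core : ∀ (h r : ℕ) (u w : Fin r → Finset (Fin h)), Function.Injective u → Function.Injective w →
      (∀ (a c : Fin h) (β γ : Bool),
        (Finset.univ.filter fun i => (a ∈ u i ↔ β = true)).card ≠
          (Finset.univ.filter fun j => (c ∈ w j ↔ γ = true)).card) →
      (∀ a c : Fin h, ¬ (Function.Injective (fun i => (u i).erase a) ∧
        Function.Injective (fun j => (w j).erase c))) →
      h + 1 ≤ r →
      (∀ (a c : Fin h) (i₁ j₁ j₀ : Fin r), (∀ i, i ≠ i₁ → (a ∈ u i ↔ a ∉ u i₁)) → j₁ ≠ j₀ →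
        w j₀ = (w j₁).erase c → ¬ Set.InjOn (fun j => (w j).erase c) {j | j ≠ j₁}) →
      (∀ (c a : Fin h) (j₁ i₁ i₀ : Fin r), (∀ j, j ≠ j₁ → (c ∈ w j ↔ c ∉ w j₁)) → i₁ ≠ i₀ →
        u i₀ = (u i₁).erase a → ¬ Set.InjOn (fun i => (u i).erase a) {i | i ≠ i₁}) →
      ∃ ℓ : Fin (h + h) → MvPolynomial (Fin (h + h)) ℂ, (∀ q, (ℓ q).totalDegree ≤ 1) ∧
        (Matrix.of fun i j : Fin r => coeff
          (∑ b ∈ u i, Finsupp.single (Fin.castAdd h b) 1 + ∑ d ∈ w j, Finsupp.single (Fin.natAdd h d) 1)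
          (∏ q, ℓ q)).det ≠ 0)
    (R : ℕ) : ∀ (h r : ℕ), r ≤ R → ∀ (u w : Fin r → Finset (Fin h)), Function.Injective u →
      Function.Injective w →
      ∃ ℓ : Fin (h + h) → MvPolynomial (Fin (h + h)) ℂ, (∀ q, (ℓ q).totalDegree ≤ 1) ∧
        (Matrix.of fun i j : Fin r => coeff
          (∑ b ∈ u i, Finsupp.single (Fin.castAdd h b) 1 + ∑ d ∈ w j, Finsupp.single (Fin.natAdd h d) 1)
          (∏ q, ℓ q)).det ≠ 0 := by
  classical
  induction R with
  | zero =>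
    intro h r hr u w hu hw
    exact chowHits_of_size_le_three h r (by omega) u w hu hw
  | succ R ih =>
    intro h r hr u w hu hw
    refine chow_hit_of_core_le (R + 1) ?_ h r hr u w hu hw
    intro h' r' u' w' hr' hu' hw' hlk hpl hsz
    by_cases hrow : ∃ (a c : Fin h') (i₁ j₁ j₀ : Fin r'), (∀ i, i ≠ i₁ → (a ∈ u' i ↔ a ∉ u' i₁)) ∧
        j₁ ≠ j₀ ∧ w' j₀ = (w' j₁).erase c ∧ Set.InjOn (fun j => (w' j).erase c) {j | j ≠ j₁}
    · -- a leaf step on the row side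
      obtain ⟨a, c, i₁, j₁, j₀, hlone, hj, hj₀, hinj⟩ := hrow
      obtain ⟨h'', rfl⟩ : ∃ h'', h' = h'' + 1 := ⟨h' - 1, by have := a.pos; omega⟩
      obtain ⟨r'', rfl⟩ : ∃ r'', r' = r'' + 1 := ⟨r' - 1, by have := i₁.pos; omega⟩
      exact chow_leafStep a c u' w' i₁ j₁ j₀ hlone hj (mem_of_edge w' hw' hj hj₀) hj₀
        (ih h'' r'' (by omega) _ _ (preimage_succAbove_injective_of_lonely a u' hu' i₁ hlone)
          (preimage_succAbove_injective_of_injOn c w' j₁ hinj))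
    by_cases hcol : ∃ (c a : Fin h') (j₁ i₁ i₀ : Fin r'), (∀ j, j ≠ j₁ → (c ∈ w' j ↔ c ∉ w' j₁)) ∧
        i₁ ≠ i₀ ∧ u' i₀ = (u' i₁).erase a ∧ Set.InjOn (fun i => (u' i).erase a) {i | i ≠ i₁}
    · -- a leaf step on the column side: swap, step, and feed the swapped reduced layout
      obtain ⟨c, a, j₁, i₁, i₀, hlone, hi, hi₀, hinj⟩ := hcol
      obtain ⟨h'', rfl⟩ : ∃ h'', h' = h'' + 1 := ⟨h' - 1, by have := a.pos; omega⟩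
      obtain ⟨r'', rfl⟩ : ∃ r'', r' = r'' + 1 := ⟨r' - 1, by have := i₁.pos; omega⟩
      refine chow_hit_swap u' w' ?_
      exact chow_leafStep c a w' u' j₁ i₁ i₀ hlone hi (mem_of_edge u' hu' hi hi₀) hi₀
        (ih h'' r'' (by omega) _ _ (preimage_succAbove_injective_of_lonely c w' hw' j₁ hlone)
          (preimage_succAbove_injective_of_injOn a u' i₁ hinj))
    -- no leaf step: a leaf-core
    push Not at hrow hcol
    exact core h' r' u' w' hu' hw' hlk hpl hsz
      (fun a c i₁ j₁ j₀ hlone hj hj₀ => hrow a c i₁ j₁ j₀ hlone hj hj₀)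
      (fun c a j₁ i₁ i₀ hlone hi hi₀ => hcol c a j₁ i₁ i₀ hlone hi hi₀)

/-- **LEAF-CORE ENGINE.**  If every injective layout `(u, w)` (height `h`, size `r`) that is LOCKED,
NOT PEELABLE at any pair of coordinates, of size `h + 1 ≤ r`, and admits NO LEAF STEP — for every
lonely row coordinate `a` and every column edge `w j₀ = (w j₁).erase c` the coordinate `c` carries a
second edge (its erasure is not injective off `j₁`), and symmetrically with rows and columns
exchanged — is hit by a product of `h + h` affine forms, then every injective layout is hit. -/
theorem chow_hit_of_leafCore
    (core : ∀ (h r : ℕ) (u w : Fin r → Finset (Fin h)), Function.Injective u → Function.Injective w →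
      (∀ (a c : Fin h) (β γ : Bool),
        (Finset.univ.filter fun i => (a ∈ u i ↔ β = true)).card ≠
          (Finset.univ.filter fun j => (c ∈ w j ↔ γ = true)).card) →
      (∀ a c : Fin h, ¬ (Function.Injective (fun i => (u i).erase a) ∧
        Function.Injective (fun j => (w j).erase c))) →
      h + 1 ≤ r →
      (∀ (a c : Fin h) (i₁ j₁ j₀ : Fin r), (∀ i, i ≠ i₁ → (a ∈ u i ↔ a ∉ u i₁)) → j₁ ≠ j₀ →
        w j₀ = (w j₁).erase c → ¬ Set.InjOn (fun j => (w j).erase c) {j | j ≠ j₁}) →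
      (∀ (c a : Fin h) (j₁ i₁ i₀ : Fin r), (∀ j, j ≠ j₁ → (c ∈ w j ↔ c ∉ w j₁)) → i₁ ≠ i₀ →
        u i₀ = (u i₁).erase a → ¬ Set.InjOn (fun i => (u i).erase a) {i | i ≠ i₁}) →
      ∃ ℓ : Fin (h + h) → MvPolynomial (Fin (h + h)) ℂ, (∀ q, (ℓ q).totalDegree ≤ 1) ∧
        (Matrix.of fun i j : Fin r => coeff
          (∑ b ∈ u i, Finsupp.single (Fin.castAdd h b) 1 + ∑ d ∈ w j, Finsupp.single (Fin.natAdd h d) 1)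
          (∏ q, ℓ q)).det ≠ 0)
    (h r : ℕ) (u w : Fin r → Finset (Fin h)) (hu : Function.Injective u)
    (hw : Function.Injective w) :
    ∃ ℓ : Fin (h + h) → MvPolynomial (Fin (h + h)) ℂ, (∀ q, (ℓ q).totalDegree ≤ 1) ∧
      (Matrix.of fun i j : Fin r => coeff
        (∑ b ∈ u i, Finsupp.single (Fin.castAdd h b) 1 + ∑ d ∈ w j, Finsupp.single (Fin.natAdd h d) 1)
        (∏ q, ℓ q)).det ≠ 0 :=
  chow_hit_of_leafCore_le core r h r le_rfl u w hu hw

/-- **Contrapositive: the structure of a minimal missed layout, sharpened.**  If some injective layout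
is NOT hit by any product of `h + h` affine forms, then some injective layout that is locked,
unpeelable at every pair of coordinates, of size `r ≥ h + 1`, AND admits no leaf step on either side,
is not hit either. -/
theorem exists_leafCore_of_not_hit {h r : ℕ} (u w : Fin r → Finset (Fin h))
    (hu : Function.Injective u) (hw : Function.Injective w)
    (hnot : ¬ ∃ ℓ : Fin (h + h) → MvPolynomial (Fin (h + h)) ℂ, (∀ q, (ℓ q).totalDegree ≤ 1) ∧
      (Matrix.of fun i j : Fin r => coeff
        (∑ b ∈ u i, Finsupp.single (Fin.castAdd h b) 1 + ∑ d ∈ w j, Finsupp.single (Fin.natAdd h d) 1)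
        (∏ q, ℓ q)).det ≠ 0) :
    ∃ (h' r' : ℕ) (u' w' : Fin r' → Finset (Fin h')), Function.Injective u' ∧ Function.Injective w' ∧
      (∀ (a c : Fin h') (β γ : Bool),
        (Finset.univ.filter fun i => (a ∈ u' i ↔ β = true)).card ≠
          (Finset.univ.filter fun j => (c ∈ w' j ↔ γ = true)).card) ∧
      (∀ a c : Fin h', ¬ (Function.Injective (fun i => (u' i).erase a) ∧
        Function.Injective (fun j => (w' j).erase c))) ∧
      h' + 1 ≤ r' ∧
      (∀ (a c : Fin h') (i₁ j₁ j₀ : Fin r'), (∀ i, i ≠ i₁ → (a ∈ u' i ↔ a ∉ u' i₁)) → j₁ ≠ j₀ →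
        w' j₀ = (w' j₁).erase c → ¬ Set.InjOn (fun j => (w' j).erase c) {j | j ≠ j₁}) ∧
      (∀ (c a : Fin h') (j₁ i₁ i₀ : Fin r'), (∀ j, j ≠ j₁ → (c ∈ w' j ↔ c ∉ w' j₁)) → i₁ ≠ i₀ →
        u' i₀ = (u' i₁).erase a → ¬ Set.InjOn (fun i => (u' i).erase a) {i | i ≠ i₁}) ∧
      ¬ ∃ ℓ : Fin (h' + h') → MvPolynomial (Fin (h' + h')) ℂ, (∀ q, (ℓ q).totalDegree ≤ 1) ∧
        (Matrix.of fun i j : Fin r' => coeff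
          (∑ b ∈ u' i, Finsupp.single (Fin.castAdd h' b) 1 + ∑ d ∈ w' j, Finsupp.single (Fin.natAdd h' d) 1)
          (∏ q, ℓ q)).det ≠ 0 := by
  by_contra hall
  push Not at hall
  exact hnot (chow_hit_of_leafCore
    (fun h r u w hu hw hlk hpl hsz hrow hcol =>
      hall h r u w hu hw hlk (fun a c h1 h2 => hpl a c ⟨h1, h2⟩) hsz hrow hcol) h r u w hu hw)

end

end Summit.ValiantsHypothesis.ValiantsHypothesis.Theorems.BarrierLever.ChowFactor
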